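import Literature.Analysis.FluidPDE.TrilinearSkew
import Literature.Analysis.FluidPDE.MollifiedField
import Literature.Analysis.FluidPDE.LerayHopfSpatialGradient
import HarnessLib

/-!
# The convective flux of a field with bounded symmetric gradient

Analysis/FluidPDE support file (serves the discharge of the barrier fact
`Literature.Barriers.AnomalousDissipation.BrenierDeLellisSzekelyhidi2011_cor1`, Brenier–De Lellis–
Székelyhidi 2011, Cor. 1: Leray solutions converge to a solution `v ∈ C([0,T]; L²)` of Euler with
`∫₀ᵀ ‖∇v + ∇vᵀ‖_∞ dt < ∞`).

**Main result** (`integral_inner_fderiv_apply_eq_neg_integral_inner_symGrad_apply`). Let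
`v ∈ L²(E; E)` be weakly divergence free with a weak gradient `G` (accepted
`Fluid.HasWeakGradient`, only locally integrable) whose symmetric part `S = G + Gᵀ` is essentially
bounded, `‖S‖ ≤ C` a.e. Then for every smooth compactly supported divergence-free field `Φ`
`∫ ⟪v, (v·∇)Φ⟫ = -∫ ⟪S v, Φ⟫`,
i.e. against divergence-free tests the convective term `(v·∇)v` *is* the `L²` field `S v`
(`‖S v‖₂ ≤ C ‖v‖₂`): pointwise `(v·∇)v = S v - ∇(½|v|²)` and the gradient is not seen by `Φ`.
This is what makes the weak Euler solution of Brenier–De Lellis–Székelyhidi, Thm. 2 / Cor. 1,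
absolutely continuous in time with values in `L²` *without* Korn's inequality (the printed proof,
p. 6 of arXiv:0912.1028, bounds `‖v‖_∞` through Korn and Sobolev instead).

**Proof.** Mollify: `vₙ = φₙ ⋆ v` is smooth, divergence free, `Dvₙ = φₙ ⋆ G`
(`Mollification`), so `Sₙ = Dvₙ + Dvₙᵀ = φₙ ⋆ S` obeys `‖Sₙ‖ ≤ C` everywhere and `Sₙ → S` a.e.
For smooth fields the identity is two integrations by parts with the compactly supported `Φ`
(`integral_inner_convect_add_eq_zero`, `integral_mul_divergence_add_eq_zero_right`):
`∫⟪vₙ,(vₙ·∇)Φ⟫ = -∫⟪(vₙ·∇)vₙ, Φ⟫` and `∫⟪Dvₙᵀ vₙ, Φ⟫ = ∫ (Φ·∇)(½|vₙ|²) = 0`. Finally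
`vₙ → v` in `L²` and `Sₙ vₙ → S v` in the pairing with `Φ` (dominated convergence).

Also recorded: the elementary algebra of `S = G + Gᵀ` (`inner_symGrad_apply`), the commutation
of mollification with the adjoint (`adjoint_normed_convolution`) and the uniform bound of a
mollified essentially bounded field (`norm_normed_convolution_le_of_ae_le`).

## Mathlib / tree search

Mathlib: `ContinuousLinearMap.adjoint`, `ContinuousLinearMap.integral_comp_commSL`, convolution
(`MeasureTheory.convolution`, `ContDiffBump.normed`). Tree: weak gradients and their
mollification (`SobolevDomain`, `Mollification`), `div (ρ ⋆ w) = 0`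
(`MollifiedField`), whole-space integration by parts (`WholeSpaceIBP`), `L²` limits of pairings
(`TrilinearSkew`). No statement about the symmetric gradient exists (searched `symGrad`,
`adjoint (G`, `Korn`).

## References

* Y. Brenier, C. De Lellis, L. Székelyhidi Jr., *Weak-strong uniqueness for measure-valued
  solutions*, Comm. Math. Phys. 305 (2011), 351–361, §3.1, Thm. 2 and Cor. 1 with condition (8)
  (arXiv:0912.1028, pp. 5–6). [BrenierDeLellisSzekelyhidi2011]
* L. C. Evans, *Partial Differential Equations*, 2nd ed. (2010), §5.3.1 Thm. 1, App. C.4 Thm. 7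
  (mollification). [Evans2010]
-/

noncomputable section

open MeasureTheory TopologicalSpace Set Function Filter ContinuousLinearMap
open scoped ENNReal NNReal Convolution InnerProductSpace RealInnerProductSpace Topology

namespace Literature.Analysis.FluidPDE

variable {E : Type*} [NormedAddCommGroup E] [InnerProductSpace ℝ E] [FiniteDimensional ℝ E]
  [MeasurableSpace E] [BorelSpace E] [CompleteSpace E]

/-! ### Algebra of the symmetric part `S = G + Gᵀ` -/

section Algebra

omit [FiniteDimensional ℝ E] [MeasurableSpace E] [BorelSpace E] in
/-- `⟪(A + Aᵀ) a, b⟫ = ⟪A a, b⟫ + ⟪a, A b⟫`. [folklore] -/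
theorem inner_symGrad_apply (A : E →L[ℝ] E) (a b : E) :
    ⟪(A + adjoint A) a, b⟫ = ⟪A a, b⟫ + ⟪a, A b⟫ := by
  rw [add_apply, inner_add_left, adjoint_inner_left]

omit [FiniteDimensional ℝ E] [MeasurableSpace E] [BorelSpace E] in
/-- `⟪(A + Aᵀ) a, a⟫ = 2 ⟪A a, a⟫`. [folklore] -/
theorem inner_symGrad_apply_self (A : E →L[ℝ] E) (a : E) :
    ⟪(A + adjoint A) a, a⟫ = 2 * ⟪A a, a⟫ := by
  rw [inner_symGrad_apply, real_inner_comm a, two_mul]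

omit [FiniteDimensional ℝ E] [MeasurableSpace E] [BorelSpace E] in
/-- The symmetric part is symmetric: `⟪(A + Aᵀ) a, b⟫ = ⟪a, (A + Aᵀ) b⟫`. [folklore] -/
theorem inner_symGrad_apply_comm (A : E →L[ℝ] E) (a b : E) :
    ⟪(A + adjoint A) a, b⟫ = ⟪a, (A + adjoint A) b⟫ := by
  rw [inner_symGrad_apply, add_apply, inner_add_right, adjoint_inner_right, add_comm]

omit [FiniteDimensional ℝ E] [MeasurableSpace E] [BorelSpace E] in
/-- A symmetric tensor only sees the symmetric part: `⟪(A + Aᵀ) a, a⟫ / 2 = ⟪A a, a⟫`, in the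
form `⟪A a, a⟫ = 2⁻¹ * ⟪(A + Aᵀ) a, a⟫`. [folklore] -/
theorem inner_apply_self_eq_half_inner_symGrad (A : E →L[ℝ] E) (a : E) :
    ⟪A a, a⟫ = 2⁻¹ * ⟪(A + adjoint A) a, a⟫ := by
  rw [inner_symGrad_apply_self]; ring

omit [FiniteDimensional ℝ E] [MeasurableSpace E] [BorelSpace E] in
/-- `|⟪(A + Aᵀ) a, b⟫| ≤ ‖A + Aᵀ‖ ‖a‖ ‖b‖`. [folklore] -/
theorem abs_inner_symGrad_apply_le (A : E →L[ℝ] E) (a b : E) :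
    |⟪(A + adjoint A) a, b⟫| ≤ ‖A + adjoint A‖ * ‖a‖ * ‖b‖ :=
  (abs_real_inner_le_norm _ _).trans (by gcongr; exact le_opNorm _ _)

end Algebra

/-! ### Mollified operator fields -/

section Mollify

variable {v : E → E} {G : E → E →L[ℝ] E}

omit [CompleteSpace E] in
/-- **The gradient of the mollification is the mollified weak gradient**, operator form:
`D(φ ⋆ v)(x) = (φ ⋆ G)(x)` (Evans, *PDE*, §5.3.1, Thm. 1; the tree's
`HasWeakFDerivOn.hasFDerivAt_convolution`). [cite: Evans2010, §5.3.1 Thm. 1] -/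
theorem HasWeakGradient.fderiv_normed_convolution (hG : HasWeakGradient v G)
    (φ : ContDiffBump (0 : E)) (x : E) :
    fderiv ℝ (φ.normed volume ⋆[lsmul ℝ ℝ, volume] v) x =
      (φ.normed volume ⋆[lsmul ℝ ℝ, volume] G) x :=
  (hG.hasFDerivAt_convolution (FunctionSpaces.isTestFunctionOn_normed φ) x).fderiv

omit [CompleteSpace E] in
/-- A field with a weak gradient is locally integrable (projection). [folklore] -/
theorem HasWeakGradient.locallyIntegrable_self (hG : HasWeakGradient v G) :
    LocallyIntegrable v volume :=
  locallyIntegrableOn_univ.1 (by simpa only [Opens.coe_top] using hG.locallyIntegrableOn)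

/-- **Mollification commutes with transposition**: `((φ ⋆ G)(x))ᵀ = (φ ⋆ Gᵀ)(x)` for a locally
integrable operator field `G` (the adjoint is a continuous linear map and passes under the
Bochner integral). [folklore] -/
theorem adjoint_normed_convolution (φ : ContDiffBump (0 : E)) (hG : LocallyIntegrable G volume)
    (x : E) :
    adjoint ((φ.normed volume ⋆[lsmul ℝ ℝ, volume] G) x) =
      (φ.normed volume ⋆[lsmul ℝ ℝ, volume] fun y => adjoint (G y)) x := by
  set L : (E →L[ℝ] E) →SL[starRingEnd ℝ] (E →L[ℝ] E) :=
    ((adjoint : (E →L[ℝ] E) ≃ₗᵢ⋆[ℝ] (E →L[ℝ] E)).toContinuousLinearEquiv :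
      (E →L[ℝ] E) →SL[starRingEnd ℝ] (E →L[ℝ] E)) with hL
  have hLapply : ∀ A : E →L[ℝ] E, L A = adjoint A := fun A => rfl
  have hint : Integrable (fun t => φ.normed volume t • G (x - t)) volume := by
    have h := ((φ.hasCompactSupport_normed (μ := volume)).convolutionExists_left (lsmul ℝ ℝ)
      φ.continuous_normed hG x).integrable
    simpa only [lsmul_apply] using h
  have hσ : ∀ (r : ℝ) (c : ℝ), starRingEnd ℝ (r • c) = r • starRingEnd ℝ c := fun r c => by
    simp
  rw [convolution_def, convolution_def]
  simp only [lsmul_apply]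
  rw [← hLapply, ← ContinuousLinearMap.integral_comp_commSL hσ L hint]
  refine integral_congr_ae (ae_of_all _ fun t => ?_)
  dsimp only
  rw [map_smulₛₗ L, hLapply]
  simp

omit [CompleteSpace E] in
/-- **A mollified essentially bounded field is bounded everywhere** by the same constant:
if `‖H‖ ≤ C` a.e. then `‖(φ ⋆ H)(x)‖ ≤ C` for all `x` (the kernel `φ(x - ·)` is a probability
density). [folklore] -/
theorem norm_normed_convolution_le_of_ae_le {F : Type*} [NormedAddCommGroup F] [NormedSpace ℝ F]
    (φ : ContDiffBump (0 : E)) {H : E → F} {C : ℝ}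
    (hC : ∀ᵐ y ∂(volume : Measure E), ‖H y‖ ≤ C) (x : E) :
    ‖(φ.normed volume ⋆[lsmul ℝ ℝ, volume] H) x‖ ≤ C := by
  rw [convolution_lsmul_swap]
  have hρx : Continuous fun y => φ.normed volume (x - y) :=
    φ.continuous_normed.comp (continuous_const.sub continuous_id)
  have hρxc : HasCompactSupport fun y => φ.normed volume (x - y) :=
    φ.hasCompactSupport_normed.comp_homeomorph (Homeomorph.subLeft x)
  have ig : Integrable (fun y => φ.normed volume (x - y)) volume :=
    hρx.integrable_of_hasCompactSupport hρxc
  have hg1 : ∫ y, φ.normed volume (x - y) = 1 := by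
    rw [integral_sub_left_eq_self (φ.normed volume) volume x, φ.integral_normed (μ := volume)]
  calc ‖∫ y, φ.normed volume (x - y) • H y‖
      ≤ ∫ y, φ.normed volume (x - y) * C := by
        refine norm_integral_le_of_norm_le (ig.mul_const C) ?_
        filter_upwards [hC] with y hy
        rw [norm_smul, Real.norm_of_nonneg (φ.nonneg_normed _)]
        exact mul_le_mul_of_nonneg_left hy (φ.nonneg_normed _)
    _ = C := by rw [integral_mul_const, hg1, one_mul]

/-- The transpose of a locally integrable operator field is locally integrable (the adjoint is
an isometry). [folklore] -/
theorem locallyIntegrable_adjoint {G : E → E →L[ℝ] E} (hG : LocallyIntegrable G volume) :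
    LocallyIntegrable (fun y => adjoint (G y)) volume :=
  hG.mono ((adjoint : (E →L[ℝ] E) ≃ₗᵢ⋆[ℝ] (E →L[ℝ] E)).continuous.comp_aestronglyMeasurable
    hG.aestronglyMeasurable) (ae_of_all _ fun y => by
      rw [LinearIsometryEquiv.norm_map])

/-- **The symmetric gradient of the mollification is the mollified symmetric gradient**:
`D(φ ⋆ v)(x) + D(φ ⋆ v)(x)ᵀ = (φ ⋆ (G + Gᵀ))(x)`. [folklore] -/
theorem HasWeakGradient.symGrad_normed_convolution (hG : HasWeakGradient v G)
    (φ : ContDiffBump (0 : E)) (x : E) :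
    fderiv ℝ (φ.normed volume ⋆[lsmul ℝ ℝ, volume] v) x +
        adjoint (fderiv ℝ (φ.normed volume ⋆[lsmul ℝ ℝ, volume] v) x) =
      (φ.normed volume ⋆[lsmul ℝ ℝ, volume] fun y => G y + adjoint (G y)) x := by
  have hGl := hG.locallyIntegrable_grad
  have hGa : LocallyIntegrable (fun y => adjoint (G y)) volume := locallyIntegrable_adjoint hGl
  have h1 : ConvolutionExistsAt (φ.normed volume) G x (lsmul ℝ ℝ) volume :=
    φ.hasCompactSupport_normed.convolutionExists_left _ φ.continuous_normed hGl x
  have h2 : ConvolutionExistsAt (φ.normed volume) (fun y => adjoint (G y)) x (lsmul ℝ ℝ) volume :=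
    φ.hasCompactSupport_normed.convolutionExists_left _ φ.continuous_normed hGa x
  rw [hG.fderiv_normed_convolution φ x, adjoint_normed_convolution φ hGl x, ← h1.distrib_add h2]
  rfl

/-- The mollified symmetric gradient is bounded by the essential bound of the symmetric
gradient: `‖D(φ ⋆ v)(x) + D(φ ⋆ v)(x)ᵀ‖ ≤ C` for all `x` if `‖G + Gᵀ‖ ≤ C` a.e. [folklore] -/
theorem HasWeakGradient.norm_symGrad_normed_convolution_le (hG : HasWeakGradient v G)
    (φ : ContDiffBump (0 : E)) {C : ℝ}
    (hC : ∀ᵐ y ∂(volume : Measure E), ‖G y + adjoint (G y)‖ ≤ C) (x : E) :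
    ‖fderiv ℝ (φ.normed volume ⋆[lsmul ℝ ℝ, volume] v) x +
        adjoint (fderiv ℝ (φ.normed volume ⋆[lsmul ℝ ℝ, volume] v) x)‖ ≤ C := by
  rw [hG.symGrad_normed_convolution φ x]
  exact norm_normed_convolution_le_of_ae_le φ hC x

end Mollify

/-! ### `L²` pairings along convergent sequences -/

section Pairing

variable {X : Type*} [MeasurableSpace X] {μ : Measure X}
variable {V : Type*} [NormedAddCommGroup V] [InnerProductSpace ℝ V]

omit [NormedAddCommGroup E] [InnerProductSpace ℝ E] [FiniteDimensional ℝ E] [MeasurableSpace E]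
  [BorelSpace E] [CompleteSpace E] in
/-- The `L²` pairing of representatives is the inner product of the classes. [folklore] -/
theorem integral_inner_eq_inner_toLp {f g : X → V} (hf : MemLp f 2 μ) (hg : MemLp g 2 μ) :
    ∫ x, ⟪f x, g x⟫ ∂μ = @inner ℝ _ _ (hf.toLp f) (hg.toLp g) := by
  rw [L2.inner_def]
  refine integral_congr_ae ?_
  filter_upwards [hf.coeFn_toLp, hg.coeFn_toLp] with x hfx hgx
  rw [hfx, hgx]

omit [NormedAddCommGroup E] [InnerProductSpace ℝ E] [FiniteDimensional ℝ E] [MeasurableSpace E]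
  [BorelSpace E] [CompleteSpace E] in
/-- **Continuity of the `L²` pairing**: if `fₙ → f` and `gₙ → g` in `L²` then
`∫ ⟪fₙ, gₙ⟫ → ∫ ⟪f, g⟫` (continuity of the inner product of the Hilbert space `L²`). [folklore] -/
theorem tendsto_integral_inner_of_tendsto_eLpNorm_two_two {ι : Type*} {l : Filter ι} {f g : ι → X → V}
    {f₀ g₀ : X → V} (hf : ∀ i, MemLp (f i) 2 μ) (hg : ∀ i, MemLp (g i) 2 μ) (hf₀ : MemLp f₀ 2 μ)
    (hg₀ : MemLp g₀ 2 μ) (hfl : Tendsto (fun i => eLpNorm (f i - f₀) 2 μ) l (𝓝 0))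
    (hgl : Tendsto (fun i => eLpNorm (g i - g₀) 2 μ) l (𝓝 0)) :
    Tendsto (fun i => ∫ x, ⟪f i x, g i x⟫ ∂μ) l (𝓝 (∫ x, ⟪f₀ x, g₀ x⟫ ∂μ)) := by
  have hF : Tendsto (fun i => (hf i).toLp (f i)) l (𝓝 (hf₀.toLp f₀)) := by
    rw [Lp.tendsto_Lp_iff_tendsto_eLpNorm']
    refine hfl.congr fun i => ?_
    refine eLpNorm_congr_ae ?_
    filter_upwards [(hf i).coeFn_toLp, hf₀.coeFn_toLp] with x h1 h2
    simp only [Pi.sub_apply, h1, h2]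
  have hG : Tendsto (fun i => (hg i).toLp (g i)) l (𝓝 (hg₀.toLp g₀)) := by
    rw [Lp.tendsto_Lp_iff_tendsto_eLpNorm']
    refine hgl.congr fun i => ?_
    refine eLpNorm_congr_ae ?_
    filter_upwards [(hg i).coeFn_toLp, hg₀.coeFn_toLp] with x h1 h2
    simp only [Pi.sub_apply, h1, h2]
  have h := hF.inner (𝕜 := ℝ) hG
  simp_rw [← integral_inner_eq_inner_toLp] at h
  exact h

omit [NormedAddCommGroup E] [InnerProductSpace ℝ E] [FiniteDimensional ℝ E] [MeasurableSpace E]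
  [BorelSpace E] [CompleteSpace E] in
/-- Measurability of `x ↦ A(x) b(x)` for measurable operator and vector fields. [folklore] -/
theorem aestronglyMeasurable_clm_apply {W : Type*} [NormedAddCommGroup W] [NormedSpace ℝ W]
    {A : X → V →L[ℝ] W} {b : X → V} (hA : AEStronglyMeasurable A μ)
    (hb : AEStronglyMeasurable b μ) : AEStronglyMeasurable (fun x => A x (b x)) μ :=
  (ContinuousLinearMap.id ℝ (V →L[ℝ] W)).aestronglyMeasurable_comp₂ hA hb

omit [NormedAddCommGroup E] [InnerProductSpace ℝ E] [FiniteDimensional ℝ E] [MeasurableSpace E]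
  [BorelSpace E] [CompleteSpace E] in
/-- A bounded measurable multiplier is `L²`-Lipschitz: `‖A b‖_{L²} ≤ M ‖b‖_{L²}` if `‖A x‖ ≤ M`
a.e. [folklore] -/
theorem eLpNorm_clm_apply_le {W : Type*} [NormedAddCommGroup W] [NormedSpace ℝ W]
    {A : X → V →L[ℝ] W} {b : X → V} {M : ℝ≥0} (hA : ∀ᵐ x ∂μ, ‖A x‖ ≤ M) (p : ℝ≥0∞) :
    eLpNorm (fun x => A x (b x)) p μ ≤ M • eLpNorm b p μ := by
  refine eLpNorm_le_nnreal_smul_eLpNorm_of_ae_le_mul ?_ p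
  filter_upwards [hA] with x hx
  exact (le_opNorm _ _).trans (mul_le_mul_of_nonneg_right hx (norm_nonneg _))

end Pairing

/-! ### The convective flux against divergence-free tests -/

section Flux

variable {v : E → E} {G : E → E →L[ℝ] E}

omit [MeasurableSpace E] [BorelSpace E] in
/-- **Smooth case.** For a `C¹` divergence-free field `w` and a `C¹` compactly supported
divergence-free field `Φ`: `∫ ⟪w, (w·∇)Φ⟫ = -∫ ⟪(Dw + Dwᵀ) w, Φ⟫`. Indeed
`∫ ⟪w, (w·∇)Φ⟫ = -∫ ⟪(w·∇)w, Φ⟫` (`integral_inner_convect_add_eq_zero`, `div w = 0`) and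
`∫ ⟪Dwᵀ w, Φ⟫ = ∫ ⟪w, (Φ·∇)w⟫ = ½ ∫ (Φ·∇)|w|² = 0` (`div Φ = 0`). [folklore] -/
theorem integral_inner_fderiv_apply_self_eq_of_contDiff [MeasurableSpace E] [BorelSpace E]
    {w Φ : E → E} (hw : ContDiff ℝ 1 w) (hwdiv : VectorCalculus.IsDivFree w)
    (hΦ : ContDiff ℝ 1 Φ) (hΦc : HasCompactSupport Φ) (hΦdiv : VectorCalculus.IsDivFree Φ) :
    ∫ x, ⟪w x, fderiv ℝ Φ x (w x)⟫ =
      -∫ x, ⟪(fderiv ℝ w x + adjoint (fderiv ℝ w x)) (w x), Φ x⟫ := by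
  -- (i) `∫ ⟪(w·∇)w, Φ⟫ + ∫ ⟪w, (w·∇)Φ⟫ = 0`
  have h1 := integral_inner_convect_add_eq_zero (u := w) (v := w) (w := Φ) hw hw hΦ hΦc
  have hdiv0 : ∫ x, VectorCalculus.divergence w x * ⟪w x, Φ x⟫ = 0 := by
    simp [hwdiv _]
  rw [hdiv0, add_zero] at h1
  simp only [convect_apply] at h1
  -- (ii) `∫ ⟪Dwᵀ w, Φ⟫ = ∫ ⟪w, Dw Φ⟫ = 0`
  have hθ : ContDiff ℝ 1 fun x => ⟪w x, w x⟫ := hw.inner ℝ hw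
  have h2 := integral_mul_divergence_add_eq_zero_right (θ := fun x => ⟪w x, w x⟫) (u := Φ) hθ hΦ hΦc
  have hdiv0' : ∫ x, ⟪w x, w x⟫ * VectorCalculus.divergence Φ x = 0 := by
    simp [hΦdiv _]
  rw [hdiv0', zero_add] at h2
  have hgrad : ∀ x, ⟪Φ x, gradient (fun y => ⟪w y, w y⟫) x⟫ = 2 * ⟪w x, fderiv ℝ w x (Φ x)⟫ := by
    intro x
    rw [gradient, real_inner_comm, InnerProductSpace.toDual_symm_apply,
      fderiv_inner_apply ℝ (hw.differentiable one_ne_zero x) (hw.differentiable one_ne_zero x),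
      real_inner_comm (fderiv ℝ w x (Φ x)) (w x), two_mul]
  simp_rw [hgrad] at h2
  rw [integral_const_mul, mul_eq_zero] at h2
  have h2' : ∫ x, ⟪w x, fderiv ℝ w x (Φ x)⟫ = 0 := h2.resolve_left two_ne_zero
  -- integrability of the two pieces of the right-hand side
  have hDw : Continuous (fderiv ℝ w) := hw.continuous_fderiv one_ne_zero
  have hsuppΦ : ∀ {f : E → ℝ}, (∀ x, Φ x = 0 → f x = 0) → HasCompactSupport f := fun hf =>
    hΦc.mono fun x hx => by contrapose! hx; simp_all
  have i1 : Integrable (fun x => ⟪fderiv ℝ w x (w x), Φ x⟫) volume :=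
    ((hDw.clm_apply hw.continuous).inner hΦ.continuous).integrable_of_hasCompactSupport
      (hsuppΦ fun x hx => by simp [hx])
  have i2 : Integrable (fun x => ⟪adjoint (fderiv ℝ w x) (w x), Φ x⟫) volume := by
    have hc : Continuous fun x => ⟪adjoint (fderiv ℝ w x) (w x), Φ x⟫ := by
      simp_rw [adjoint_inner_left]
      exact hw.continuous.inner (hDw.clm_apply hΦ.continuous)
    exact hc.integrable_of_hasCompactSupport (hsuppΦ fun x hx => by simp [hx])
  simp_rw [add_apply, inner_add_left]
  rw [integral_add i1 i2]
  simp_rw [adjoint_inner_left]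
  rw [h2', add_zero]
  linarith

/-- **The convective flux of a field with bounded symmetric gradient** (the identity behind
Brenier–De Lellis–Székelyhidi 2011, Thm. 2 / Cor. 1 under condition (8)
`∇v + ∇vᵀ ∈ L¹(0,T; L^∞)`: it makes `∂ₜ v = -P((∇v + ∇vᵀ) v) ∈ L¹(0,T; L²)`). Let `v ∈ L²(E;E)`
be weakly divergence free with a weak gradient `G` and `‖G + Gᵀ‖ ≤ C` a.e. Then for every smooth
compactly supported divergence-free `Φ`
`∫ ⟪v, (v·∇)Φ⟫ = -∫ ⟪(G + Gᵀ) v, Φ⟫`.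
Proof in the module docstring (mollify, `integral_inner_fderiv_apply_self_eq_of_contDiff`,
pass to the limit). [cite: BrenierDeLellisSzekelyhidi2011, §3.1 Thm. 2 with (8)] -/
theorem integral_inner_fderiv_apply_self_eq_neg_integral_inner_symGrad
    (hv2 : MemLp v 2 volume) (hdiv : IsWeaklyDivFree v) (hG : HasWeakGradient v G) {C : ℝ}
    (hC : ∀ᵐ x ∂(volume : Measure E), ‖G x + adjoint (G x)‖ ≤ C) {Φ : E → E}
    (hΦ : FunctionSpaces.IsTestFunctionOn (⊤ : Opens E) Φ) (hΦdiv : VectorCalculus.IsDivFree Φ) :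
    ∫ x, ⟪v x, fderiv ℝ Φ x (v x)⟫ = -∫ x, ⟪(G x + adjoint (G x)) (v x), Φ x⟫ := by
  obtain ⟨φ, hφ, h'φ⟩ := FunctionSpaces.exists_contDiffBump_seq (E := E)
  have hK : ∀ n, FunctionSpaces.IsTestFunctionOn (⊤ : Opens E) ((φ n).normed volume) := fun n =>
    FunctionSpaces.isTestFunctionOn_normed (φ n)
  have hvl : LocallyIntegrable v volume := hG.locallyIntegrable_self
  have hC0 : 0 ≤ C := by
    obtain ⟨x, hx⟩ := hC.exists
    exact (norm_nonneg _).trans hx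
  set Cn : ℝ≥0 := ⟨C, hC0⟩ with hCn
  -- the mollified fields
  set vn : ℕ → E → E := fun n => (φ n).normed volume ⋆[lsmul ℝ ℝ, volume] v with hvn
  have hvn_s : ∀ n, ContDiff ℝ 1 (vn n) := fun n => hG.contDiff_convolution (hK n)
  have hvn_div : ∀ n, VectorCalculus.IsDivFree (vn n) := fun n x =>
    divergence_convolution_eq_zero (φ n).contDiff_normed (φ n).hasCompactSupport_normed hvl hdiv x
  have hvn_2 : ∀ n, MemLp (vn n) 2 volume := fun n =>
    FunctionSpaces.memLp_normed_convolution (φ n) hv2 one_le_two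
  have hvn_lim : Tendsto (fun n => eLpNorm (vn n - v) 2 volume) atTop (𝓝 0) :=
    FunctionSpaces.tendsto_eLpNorm_normed_convolution_sub_self (μ := (volume : Measure E)) hφ
      one_le_two ENNReal.ofNat_ne_top hv2
  -- the symmetric gradients
  set S : E → E →L[ℝ] E := fun x => G x + adjoint (G x) with hS
  set Sn : ℕ → E → E →L[ℝ] E := fun n x =>
    fderiv ℝ (vn n) x + adjoint (fderiv ℝ (vn n) x) with hSn
  have hSn_eq : ∀ n x, Sn n x = ((φ n).normed volume ⋆[lsmul ℝ ℝ, volume] S) x := fun n x =>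
    hG.symGrad_normed_convolution (φ n) x
  have hSn_le : ∀ n x, ‖Sn n x‖ ≤ C := fun n x => hG.norm_symGrad_normed_convolution_le (φ n) hC x
  have hSl : LocallyIntegrable S volume :=
    LocallyIntegrable.add (ε'' := E →L[ℝ] E) hG.locallyIntegrable_grad
      (locallyIntegrable_adjoint hG.locallyIntegrable_grad)
  have hSm : AEStronglyMeasurable S volume := hSl.aestronglyMeasurable
  have hSn_c : ∀ n, Continuous (Sn n) := fun n => by
    have hD : Continuous (fderiv ℝ (vn n)) := (hvn_s n).continuous_fderiv one_ne_zero
    exact hD.add ((adjoint : (E →L[ℝ] E) ≃ₗᵢ⋆[ℝ] (E →L[ℝ] E)).continuous.comp hD)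
  have hSn_ae : ∀ᵐ x ∂(volume : Measure E), Tendsto (fun n => Sn n x) atTop (𝓝 (S x)) := by
    filter_upwards [FunctionSpaces.ae_tendsto_normed_convolution hφ h'φ hSl] with x hx
    simpa only [hSn_eq] using hx
  -- test field data
  have hΦ1 : ContDiff ℝ 1 Φ := hΦ.contDiff.of_le (by exact_mod_cast le_top)
  have hΦc : HasCompactSupport Φ := hΦ.hasCompactSupport
  have hΦ2 : MemLp Φ 2 volume := hΦ.contDiff.continuous.memLp_of_hasCompactSupport hΦc
  obtain ⟨M, hM⟩ := (hΦ1.continuous_fderiv one_ne_zero).bounded_above_of_compact_support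
    (hΦc.fderiv ℝ)
  have hM0 : 0 ≤ M := (norm_nonneg _).trans (hM 0)
  set Mn : ℝ≥0 := ⟨M, hM0⟩ with hMn
  have hDΦm : AEStronglyMeasurable (fderiv ℝ Φ) volume :=
    (hΦ1.continuous_fderiv one_ne_zero).aestronglyMeasurable
  -- the identity at stage `n`
  have hstage : ∀ n, ∫ x, ⟪vn n x, fderiv ℝ Φ x (vn n x)⟫ = -∫ x, ⟪Sn n x (vn n x), Φ x⟫ :=
    fun n => integral_inner_fderiv_apply_self_eq_of_contDiff (hvn_s n) (hvn_div n) hΦ1 hΦc hΦdiv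
  -- ### limit of the left-hand side
  have hLHS : Tendsto (fun n => ∫ x, ⟪vn n x, fderiv ℝ Φ x (vn n x)⟫) atTop
      (𝓝 (∫ x, ⟪v x, fderiv ℝ Φ x (v x)⟫)) := by
    have hmem : ∀ w : E → E, MemLp w 2 volume → MemLp (fun x => fderiv ℝ Φ x (w x)) 2 volume :=
      fun w hw => by
        refine ⟨aestronglyMeasurable_clm_apply hDΦm hw.1, ?_⟩
        refine (eLpNorm_clm_apply_le (M := Mn) (ae_of_all _ hM) 2).trans_lt ?_
        exact ENNReal.mul_lt_top ENNReal.coe_lt_top hw.eLpNorm_lt_top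
    refine tendsto_integral_inner_of_tendsto_eLpNorm_two_two hvn_2 (fun n => hmem _ (hvn_2 n)) hv2
      (hmem _ hv2) hvn_lim ?_
    have hle : ∀ n, eLpNorm ((fun x => fderiv ℝ Φ x (vn n x)) - fun x => fderiv ℝ Φ x (v x)) 2
        volume ≤ Mn • eLpNorm (vn n - v) 2 volume := fun n => by
      have : ((fun x => fderiv ℝ Φ x (vn n x)) - fun x => fderiv ℝ Φ x (v x)) =
          fun x => fderiv ℝ Φ x ((vn n - v) x) := by
        ext1 x; simp only [Pi.sub_apply, map_sub]
      rw [this]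
      exact eLpNorm_clm_apply_le (ae_of_all _ hM) 2
    refine tendsto_of_tendsto_of_tendsto_of_le_of_le tendsto_const_nhds ?_ (fun _ => zero_le) hle
    have := ENNReal.Tendsto.const_mul hvn_lim (a := (Mn : ℝ≥0∞)) (Or.inr ENNReal.coe_ne_top)
    simpa only [mul_zero, ENNReal.smul_def, smul_eq_mul] using this
  -- ### limit of the right-hand side
  have hRHS : Tendsto (fun n => ∫ x, ⟪Sn n x (vn n x), Φ x⟫) atTop
      (𝓝 (∫ x, ⟪S x (v x), Φ x⟫)) := by
    have hSv2 : ∀ {A : E → E →L[ℝ] E} {w : E → E}, AEStronglyMeasurable A volume →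
        (∀ᵐ x ∂(volume : Measure E), ‖A x‖ ≤ C) → MemLp w 2 volume →
        MemLp (fun x => A x (w x)) 2 volume := fun hA hAC hw => by
      refine ⟨aestronglyMeasurable_clm_apply hA hw.1, ?_⟩
      refine (eLpNorm_clm_apply_le (M := Cn) hAC 2).trans_lt ?_
      exact ENNReal.mul_lt_top ENNReal.coe_lt_top hw.eLpNorm_lt_top
    have hmem_n : ∀ n, MemLp (fun x => Sn n x (vn n x)) 2 volume := fun n =>
      hSv2 (hSn_c n).aestronglyMeasurable (ae_of_all _ (hSn_le n)) (hvn_2 n)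
    have hmem : MemLp (fun x => S x (v x)) 2 volume := hSv2 hSm hC hv2
    refine tendsto_integral_inner_of_tendsto_eLpNorm_two_two hmem_n (fun _ => hΦ2) hmem hΦ2 ?_
      (by simp)
    -- `Sₙ vₙ - S v = Sₙ (vₙ - v) + (Sₙ - S) v`
    have hsplit : ∀ n, eLpNorm ((fun x => Sn n x (vn n x)) - fun x => S x (v x)) 2 volume ≤
        Cn • eLpNorm (vn n - v) 2 volume + eLpNorm (fun x => (Sn n x - S x) (v x)) 2 volume := by
      intro n
      have heq : ((fun x => Sn n x (vn n x)) - fun x => S x (v x)) =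
          (fun x => Sn n x ((vn n - v) x)) + fun x => (Sn n x - S x) (v x) := by
        ext1 x
        simp only [Pi.sub_apply, Pi.add_apply, map_sub, sub_apply]
        abel
      rw [heq]
      refine (eLpNorm_add_le ?_ ?_ one_le_two).trans (add_le_add ?_ le_rfl)
      · exact aestronglyMeasurable_clm_apply (hSn_c n).aestronglyMeasurable ((hvn_2 n).sub hv2).1
      · exact aestronglyMeasurable_clm_apply ((hSn_c n).aestronglyMeasurable.sub hSm) hv2.1
      · exact eLpNorm_clm_apply_le (ae_of_all _ (hSn_le n)) 2
    -- the first piece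
    have hA : Tendsto (fun n => (Cn : ℝ≥0∞) * eLpNorm (vn n - v) 2 volume) atTop (𝓝 0) := by
      have := ENNReal.Tendsto.const_mul hvn_lim (a := (Cn : ℝ≥0∞)) (Or.inr ENNReal.coe_ne_top)
      simpa only [mul_zero] using this
    -- the second piece by dominated convergence
    have hB : Tendsto (fun n => eLpNorm (fun x => (Sn n x - S x) (v x)) 2 volume) atTop (𝓝 0) := by
      have hlin : Tendsto (fun n => ∫⁻ x, ‖(Sn n x - S x) (v x)‖ₑ ^ (2 : ℝ)) atTop (𝓝 0) := by
        have hbound : ∀ n, ∀ᵐ x ∂(volume : Measure E),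
            ‖(Sn n x - S x) (v x)‖ₑ ^ (2 : ℝ) ≤ (ENNReal.ofReal (2 * C)) ^ (2 : ℝ) * ‖v x‖ₑ ^ (2 : ℝ) := by
          intro n
          filter_upwards [hC] with x hx
          rw [← ENNReal.mul_rpow_of_nonneg _ _ zero_le_two]
          refine ENNReal.rpow_le_rpow ?_ zero_le_two
          have h1 : ‖(Sn n x - S x) (v x)‖ ≤ 2 * C * ‖v x‖ := by
            refine (le_opNorm _ _).trans (mul_le_mul_of_nonneg_right ?_ (norm_nonneg _))
            exact (norm_sub_le _ _).trans (by linarith [hSn_le n x])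
          rw [← ofReal_norm, ← ofReal_norm, ← ENNReal.ofReal_mul (by linarith)]
          exact ENNReal.ofReal_le_ofReal h1
        have hfin : ∫⁻ x, (ENNReal.ofReal (2 * C)) ^ (2 : ℝ) * ‖v x‖ₑ ^ (2 : ℝ) ≠ ⊤ := by
          rw [lintegral_const_mul' _ _ (ENNReal.rpow_ne_top_of_nonneg zero_le_two
            ENNReal.ofReal_ne_top), lintegral_rpow_enorm_eq_rpow_eLpNorm' zero_lt_two]
          refine ENNReal.mul_ne_top (ENNReal.rpow_ne_top_of_nonneg zero_le_two
            ENNReal.ofReal_ne_top) (ENNReal.rpow_ne_top_of_nonneg zero_le_two ?_)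
          have := hv2.eLpNorm_lt_top
          rw [eLpNorm_eq_eLpNorm' two_ne_zero ENNReal.ofNat_ne_top] at this
          simpa using this.ne
        have hmeas : ∀ n, AEMeasurable (fun x => ‖(Sn n x - S x) (v x)‖ₑ ^ (2 : ℝ)) volume :=
          fun n => (aestronglyMeasurable_clm_apply ((hSn_c n).aestronglyMeasurable.sub hSm)
            hv2.1).enorm.pow_const _
        have hlim : ∀ᵐ x ∂(volume : Measure E),
            Tendsto (fun n => ‖(Sn n x - S x) (v x)‖ₑ ^ (2 : ℝ)) atTop (𝓝 0) := by
          filter_upwards [hSn_ae] with x hx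
          have h2 : Tendsto (fun n => Sn n x - S x) atTop (𝓝 0) := by
            simpa using hx.sub_const (S x)
          have h1 : Tendsto (fun n => (Sn n x - S x) (v x)) atTop (𝓝 ((0 : E →L[ℝ] E) (v x))) :=
            ((ContinuousLinearMap.apply ℝ E (v x)).continuous.tendsto 0).comp h2
          rw [_root_.zero_apply] at h1
          have h4 : Tendsto (fun n => ‖(Sn n x - S x) (v x)‖ₑ) atTop (𝓝 0) := by
            rw [← enorm_zero (E := E)]
            exact h1.enorm
          have h5 := ((ENNReal.continuous_rpow_const (y := (2 : ℝ))).tendsto 0).comp h4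
          rw [ENNReal.zero_rpow_of_pos zero_lt_two] at h5
          exact h5
        have := tendsto_lintegral_of_dominated_convergence' _ hmeas hbound hfin hlim
        simpa using this
      have h2 : ∀ n, eLpNorm (fun x => (Sn n x - S x) (v x)) 2 volume =
          (∫⁻ x, ‖(Sn n x - S x) (v x)‖ₑ ^ (2 : ℝ)) ^ (1 / 2 : ℝ) := fun n => by
        rw [eLpNorm_eq_lintegral_rpow_enorm_toReal two_ne_zero ENNReal.ofNat_ne_top, ENNReal.toReal_ofNat]
      simp_rw [h2]
      have h6 := ((ENNReal.continuous_rpow_const (y := (1 / 2 : ℝ))).tendsto 0).comp hlin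
      rw [ENNReal.zero_rpow_of_pos (by norm_num : (0 : ℝ) < 1 / 2)] at h6
      exact h6
    refine tendsto_of_tendsto_of_tendsto_of_le_of_le tendsto_const_nhds ?_ (fun _ => zero_le)
      (fun n => (hsplit n).trans_eq (by rw [ENNReal.smul_def, smul_eq_mul]))
    simpa using hA.add hB
  -- ### conclusion
  have h := hLHS
  simp_rw [hstage] at h
  exact tendsto_nhds_unique h hRHS.neg

end Flux

end Literature.Analysis.FluidPDE
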